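import Mathlib
import HarnessLib
import Summits.Ventures.LatticeQCDFlow.Exactness.CenteredExponentialMomentFloor
import Summits.Ventures.LatticeQCDFlow.Exactness.LatticeBlockEntropyFloor
import Summits.Ventures.LatticeQCDFlow.Exactness.LatticeCoordAvgTower
import Summits.Ventures.LatticeQCDFlow.Exactness.SphereLOFlowLocalizedSiteTerms

/-!
# A static, local criterion for the positivity of the block fluctuations of the entropy floor: if re-drawing one interior spin changes the local energy around it, then `s_j > 0`

HONEST FRAMING: exact (Metropolis-corrected) sampling algorithms for lattice gauge theory;
figures of merit are autocorrelation/cost numbers at stated couplings and volumes; no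
continuum-physics claim.

Venture `LatticeQCDFlow` (cell pub-lqcd), topic `Exactness`; FANOUT row 7 (`s0-cpn-null`).  NEW WORK
of the cell over this lineage's `Exactness/LatticeCoordAvgTower.lean` (tower property, non-constancy
is inherited by finer averages), `Exactness/LatticeBlockEntropyFloor.lean` (locality of `A_s`), `Exactness/SphereLOFlowLocalizedSiteTerms.lean` (the site term
`v_n(y) = (2κ²/(d−1))‖p_n(y)‖²` reads only `N n = {n} ∪ couplingNbhd U n`) and
`Exactness/CenteredExponentialMomentFloor.lean` (positivity of the mean absolute deviation of a
non-constant continuous functional under a full-support law); nothing is cited as a fact.  Context: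
the extensive floor with the static germ (`Exactness/SphereLOFlowEntropyFloorGerm.lean`) bounds the
reverse relative entropy of the exact LO flow sampler below by `Σ_j log(1 + (max 0 ((c²/2)s_j − O(c³)))²/8)`
minus a cone tail, `s_j = ∫|A_C V_j − ∫V_j dπ̄| dπ̄` the corridor-averaged mean absolute deviation of the
STATIC block term `V_j = Σ_{n∈I_j} v_n`.  THIS FILE reduces `s_j > 0` to a finite-dimensional,
flow-free and volume-free condition on the couplings near ONE site: if a site `k` has its radius-2
coupling ball inside the block and the local energy `L_k = Σ_{n ∈ {k} ∪ N k} v_n` is changed by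
re-drawing the spin at `k` in some configuration, then `A_C V` is non-constant and its mean absolute
deviation is positive — for every corridor set `C` inside a coordinate set `s` that misses the
radius-2 coupling ball of `k`, and every index set `I` (the terms outside `{k} ∪ N k` do not read `k`).

## Content

* §1 `dependsOn_loCarreSite` (`v_n` depends only on `{n} ∪ N n`), `coordAvg_eq_self_of_dependsOn_disjoint`
  (`A_s G = G` if `G` reads no coordinate of `s`), `coordAvg_update_eq_of_not_mem`
  (`A_s G (ω[k ← u]) = A_s G ω` if `G` does not read `k`).
* §2 **`coordAvg_loCarreBlock_update_sub`** — for `s` disjoint from `nball N 2 k` and any index set `I`: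
  `A_s V_I(ω[k ← u]) − A_s V_I(ω) = L_k(ω[k ← u]) − L_k(ω)`.
* §3 **`integral_abs_coordAvg_loCarreBlock_sub_pos`** — THE STATIC CRITERION: under the same
  hypotheses plus `C ⊆ s`, if `L_k(ω₀[k ← u]) ≠ L_k(ω₀)` for some `ω₀ ∈ Ω`, `u ∈ S(E)`, then
  `0 < ∫|A_C V_I − ∫V_I dπ̄| dπ̄`.

NOT CLAIMED: the verification of the one-site condition for a specific coupling (e.g. the rung's
nearest-neighbour CP⁹ links) — a finite-dimensional computation left to the user of the criterion;
anything about the flow or numbers.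
-/

noncomputable section

namespace Summit.Ventures.LatticeQCDFlow.Exactness

open Function Set Metric MeasureTheory NormedSpace InnerProductSpace
open scoped RealInnerProductSpace Topology Nat Classical

variable {Λ : Type*} {E : Type*} [NormedAddCommGroup E] [InnerProductSpace ℝ E]
  [FiniteDimensional ℝ E] [Fintype Λ] [DecidableEq Λ]

/-! ## §1 Read sets of the static site terms; two facts about coordinate averages -/

section ReadSets

variable {U : Λ → Λ → (E →L[ℝ] E)}

omit [FiniteDimensional ℝ E] [DecidableEq Λ] in
/-- **The static site term `ω ↦ v_n(ω)` depends only on the coordinates in `{n} ∪ couplingNbhd U n`.** -/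
theorem dependsOn_loCarreSite (hd : 2 ≤ Module.finrank ℝ E) (κ : ℝ) (n : Λ) :
    DependsOn (fun ω : Λ → sphere (0 : E) 1 => 2 * κ ^ 2 / ((Module.finrank ℝ E : ℝ) - 1) *
        ‖tangentKick (localField U n (fun i => ((ω i : sphere (0 : E) 1) : E))) (ω n : E)‖ ^ 2)
      (insert n (couplingNbhd U n)) := by
  intro ω ω' hagree
  set υ : ℝ := Finset.univ.sup' ⟨n, Finset.mem_univ n⟩ fun k => ∑ m, ‖U k m‖ with hυdef
  have hυ' : ∀ k, ∑ m, ‖U k m‖ ≤ υ := fun k =>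
    Finset.le_sup' (fun k => ∑ m, ‖U k m‖) (Finset.mem_univ k)
  have h := abs_loCarreSite_sub_le hd κ hυ' n (norm_sphereConfig_eq_one ω) (norm_sphereConfig_eq_one ω')
    le_rfl (η := 0) fun j hj => by
      have := hagree j hj
      simp only [this, sub_self, norm_zero, le_refl]
  rw [mul_zero] at h
  exact sub_eq_zero.1 (abs_nonpos_iff.1 h)

variable {ι : Type*} [Fintype ι] [DecidableEq ι] {X : Type*} [MeasurableSpace X]
  (μ : Measure X) [IsProbabilityMeasure μ]

omit [IsProbabilityMeasure μ] in
/-- **`A_s G = G` if `G` reads no coordinate of `s`.** -/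
theorem coordAvg_eq_self_of_dependsOn_disjoint [IsProbabilityMeasure μ] (s : Finset ι) {G : (ι → X) → ℝ}
    {R : Set ι} (hG : DependsOn G R) (hRs : Disjoint R ↑s) (ω : ι → X) : coordAvg μ s G ω = G ω := by
  unfold coordAvg
  have h : ∀ ω' : ι → X, G (s.piecewise ω' ω) = G ω := fun ω' =>
    hG fun i hi => Finset.piecewise_eq_of_notMem _ _ _ fun his => Set.disjoint_left.1 hRs hi his
  simp_rw [h]
  rw [integral_const, smul_eq_mul, probReal_univ, one_mul]

omit [IsProbabilityMeasure μ] in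
/-- **`A_s G(ω[k ← u]) = A_s G(ω)` if `G` does not read the coordinate `k`.** -/
theorem coordAvg_update_eq_of_not_mem (s : Finset ι) {G : (ι → X) → ℝ} {R : Set ι} (hG : DependsOn G R)
    {k : ι} (hk : k ∉ R) (ω : ι → X) (u : X) : coordAvg μ s G (update ω k u) = coordAvg μ s G ω :=
  dependsOn_coordAvg μ s hG fun i hi => by
    rcases hi with ⟨hiR, _⟩
    exact update_of_ne (fun h : i = k => hk (by rw [← h]; exact hiR)) _ _

end ReadSets

/-! ## §2 Re-drawing one interior spin moves the corridor average by the local energy change -/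

section Static

variable [MeasurableSpace E] [BorelSpace E] [Nontrivial E] {U : Λ → Λ → (E →L[ℝ] E)}

/-- **THE CORRIDOR AVERAGE SEES AN INTERIOR RE-DRAW EXACTLY THROUGH THE LOCAL ENERGY.**  Adjoint pairs
(so `couplingNbhd` is symmetric); `s` a set of coordinates disjoint from the radius-2 coupling ball of
`k`; `I` any finite set of sites.  Then for the static block term `V_I = Σ_{n∈I} v_n` and the local
energy `L_k = Σ_{n ∈ I, n ∈ {k} ∪ N k} v_n`:
`A_s V_I(ω[k ← u]) − A_s V_I(ω) = L_k(ω[k ← u]) − L_k(ω)` (the terms around `k` read no coordinate of `s`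
and pass through `A_s` unchanged; the other terms do not read `k`). -/
theorem coordAvg_loCarreBlock_update_sub (hUadj : ∀ m n (v w : E), ⟪U m n v, w⟫ = ⟪v, U n m w⟫)
    (hd : 2 ≤ Module.finrank ℝ E) (κ : ℝ) {k : Λ} {s : Finset Λ}
    (hs : Disjoint (nball (fun n => insert n (couplingNbhd U n)) 2 k) ↑s) (I : Finset Λ)
    (ω : Λ → sphere (0 : E) 1) (u : sphere (0 : E) 1) :
    coordAvg (uniformSphere (volume : Measure E)) s (fun ω => ∑ n ∈ I,
        2 * κ ^ 2 / ((Module.finrank ℝ E : ℝ) - 1) *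
          ‖tangentKick (localField U n (fun i => ((ω i : sphere (0 : E) 1) : E))) (ω n : E)‖ ^ 2)
        (update ω k u) -
      coordAvg (uniformSphere (volume : Measure E)) s (fun ω => ∑ n ∈ I,
        2 * κ ^ 2 / ((Module.finrank ℝ E : ℝ) - 1) *
          ‖tangentKick (localField U n (fun i => ((ω i : sphere (0 : E) 1) : E))) (ω n : E)‖ ^ 2) ω =
      ∑ n ∈ I.filter (fun n => n ∈ insert k (couplingNbhd U k)),
          2 * κ ^ 2 / ((Module.finrank ℝ E : ℝ) - 1) *
            ‖tangentKick (localField U n (fun i => (((update ω k u) i : sphere (0 : E) 1) : E)))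
              ((update ω k u) n : E)‖ ^ 2 -
        ∑ n ∈ I.filter (fun n => n ∈ insert k (couplingNbhd U k)),
          2 * κ ^ 2 / ((Module.finrank ℝ E : ℝ) - 1) *
            ‖tangentKick (localField U n (fun i => ((ω i : sphere (0 : E) 1) : E))) (ω n : E)‖ ^ 2 := by
  set μ := uniformSphere (volume : Measure E) with hμ
  set N : Λ → Set Λ := fun n => insert n (couplingNbhd U n) with hN
  set v : Λ → (Λ → sphere (0 : E) 1) → ℝ := fun n ω => 2 * κ ^ 2 / ((Module.finrank ℝ E : ℝ) - 1) *
    ‖tangentKick (localField U n (fun i => ((ω i : sphere (0 : E) 1) : E))) (ω n : E)‖ ^ 2 with hv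
  have hvc : ∀ n, Continuous (v n) := fun n =>
    (continuous_loCarreSite (U := U) κ n).comp continuous_sphereConfig
  have hvdep : ∀ n, DependsOn (v n) (N n) := fun n => dependsOn_loCarreSite (U := U) hd κ n
  -- symmetry of the coupling neighbourhoods (adjoint pairs)
  have hsymm : ∀ a b : Λ, a ∈ couplingNbhd U b → b ∈ couplingNbhd U a := by
    intro a b hab hba
    apply hab
    ext w
    have h0 : ∀ v', ⟪U b a w, v'⟫ = 0 := fun v' => by
      rw [hUadj b a w v', show U a b = 0 from hba]; simp
    simpa using h0 (U b a w)
  -- split the block sum into the terms around `k` and the rest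
  set P : Finset Λ := I.filter (fun n => n ∈ N k) with hP
  set Q : Finset Λ := I.filter (fun n => n ∉ N k) with hQ
  have hsplit : ∀ η : Λ → sphere (0 : E) 1, ∑ n ∈ I, v n η = ∑ n ∈ P, v n η + ∑ n ∈ Q, v n η := by
    intro η; rw [hP, hQ, ← Finset.sum_filter_add_sum_filter_not I (fun n => n ∈ N k)]
  have hPc : Continuous fun η : Λ → sphere (0 : E) 1 => ∑ n ∈ P, v n η := continuous_finsetSum _ fun n _ => hvc n
  have hQc : Continuous fun η : Λ → sphere (0 : E) 1 => ∑ n ∈ Q, v n η := continuous_finsetSum _ fun n _ => hvc n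
  -- the terms around `k` read only `nball N 2 k`, disjoint from `s`
  have hPdep : DependsOn (fun η : Λ → sphere (0 : E) 1 => ∑ n ∈ P, v n η) (nball N 2 k) := by
    intro η η' hagree
    refine Finset.sum_congr rfl fun n hn => hvdep n fun i hi => hagree i ?_
    have hnk : n ∈ N k := (Finset.mem_filter.1 hn).2
    have hn1 : n ∈ nball N 1 k := subset_nball_one k hnk
    exact nball_subset_nball_add hn1 1 (subset_nball_one n hi)
  -- the other terms do not read `k`
  have hQdep : DependsOn (fun η : Λ → sphere (0 : E) 1 => ∑ n ∈ Q, v n η) (⋃ n ∈ Q, N n) := by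
    intro η η' hagree
    exact Finset.sum_congr rfl fun n hn => hvdep n fun i hi => hagree i (mem_biUnion hn hi)
  have hkQ : k ∉ ⋃ n ∈ Q, N n := by
    intro hk
    obtain ⟨n, hn, hkn⟩ := mem_iUnion₂.1 hk
    have hnN : n ∉ N k := (Finset.mem_filter.1 hn).2
    rcases (Set.mem_insert_iff).1 hkn with h | h
    · exact hnN (h ▸ Set.mem_insert _ _)
    · exact hnN (Set.mem_insert_of_mem _ (hsymm k n h))
  have hA : ∀ η : Λ → sphere (0 : E) 1, coordAvg μ s (fun η => ∑ n ∈ I, v n η) η =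
      (∑ n ∈ P, v n η) + coordAvg μ s (fun η => ∑ n ∈ Q, v n η) η := by
    intro η
    have e : (fun η : Λ → sphere (0 : E) 1 => ∑ n ∈ I, v n η) =
        fun η => (∑ n ∈ P, v n η) + ∑ n ∈ Q, v n η := funext hsplit
    rw [e, coordAvg_add μ s hPc hQc, coordAvg_eq_self_of_dependsOn_disjoint μ s hPdep hs]
  simp only [hv] at hA
  rw [hA (update ω k u), hA ω, coordAvg_update_eq_of_not_mem μ s hQdep hkQ ω u]
  simp only [hP, hN]
  ring

/-- **THE STATIC CRITERION FOR A POSITIVE BLOCK FLUCTUATION.**  Adjoint pairs, `d ≥ 2`; a site `k`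
whose radius-2 coupling ball misses the coordinate set `s`, corridors `C ⊆ s`, any index set `I`.  If
re-drawing the spin at `k` changes the local energy `L_k = Σ_{n∈I, n ∈ {k} ∪ N k} v_n`
in some configuration, `L_k(ω₀[k ← u]) ≠ L_k(ω₀)`, then the corridor average of the static block term
is non-constant and `0 < ∫|A_C V_I − ∫V_I dπ̄| dπ̄` — the block fluctuation `s_j` of the entropy floor
is positive (take `s = Λ ∖ B_j ⊇ C`, `I = I_j`). -/
theorem integral_abs_coordAvg_loCarreBlock_sub_pos (hUadj : ∀ m n (v w : E), ⟪U m n v, w⟫ = ⟪v, U n m w⟫)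
    (hd : 2 ≤ Module.finrank ℝ E) (κ : ℝ) {k : Λ} {s C : Finset Λ} (hCs : C ⊆ s)
    (hs : Disjoint (nball (fun n => insert n (couplingNbhd U n)) 2 k) ↑s) (I : Finset Λ)
    {ω₀ : Λ → sphere (0 : E) 1} {u : sphere (0 : E) 1}
    (hL : ∑ n ∈ I.filter (fun n => n ∈ insert k (couplingNbhd U k)),
          2 * κ ^ 2 / ((Module.finrank ℝ E : ℝ) - 1) *
            ‖tangentKick (localField U n (fun i => (((update ω₀ k u) i : sphere (0 : E) 1) : E)))
              ((update ω₀ k u) n : E)‖ ^ 2 ≠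
        ∑ n ∈ I.filter (fun n => n ∈ insert k (couplingNbhd U k)),
          2 * κ ^ 2 / ((Module.finrank ℝ E : ℝ) - 1) *
            ‖tangentKick (localField U n (fun i => ((ω₀ i : sphere (0 : E) 1) : E))) (ω₀ n : E)‖ ^ 2) :
    0 < ∫ ω, |coordAvg (uniformSphere (volume : Measure E)) C (fun ω => ∑ n ∈ I,
          2 * κ ^ 2 / ((Module.finrank ℝ E : ℝ) - 1) *
            ‖tangentKick (localField U n (fun i => ((ω i : sphere (0 : E) 1) : E))) (ω n : E)‖ ^ 2) ω -
        ∫ ω', (∑ n ∈ I, 2 * κ ^ 2 / ((Module.finrank ℝ E : ℝ) - 1) *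
            ‖tangentKick (localField U n (fun i => ((ω' i : sphere (0 : E) 1) : E))) (ω' n : E)‖ ^ 2)
          ∂Measure.pi (fun _ : Λ => uniformSphere (volume : Measure E))|
        ∂Measure.pi (fun _ : Λ => uniformSphere (volume : Measure E)) := by
  set μ := uniformSphere (volume : Measure E) with hμ
  set V : (Λ → sphere (0 : E) 1) → ℝ := fun ω => ∑ n ∈ I, 2 * κ ^ 2 / ((Module.finrank ℝ E : ℝ) - 1) *
    ‖tangentKick (localField U n (fun i => ((ω i : sphere (0 : E) 1) : E))) (ω n : E)‖ ^ 2 with hV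
  have hVc : Continuous V := continuous_finsetSum _ fun n _ =>
    (continuous_loCarreSite (U := U) κ n).comp continuous_sphereConfig
  -- `A_s V` is non-constant
  have hne : coordAvg μ s V (update ω₀ k u) ≠ coordAvg μ s V ω₀ := by
    intro h
    have hsub := coordAvg_loCarreBlock_update_sub hUadj hd κ hs I ω₀ u
    rw [← hμ] at hsub
    have : coordAvg μ s V (update ω₀ k u) - coordAvg μ s V ω₀ = 0 := by rw [h, sub_self]
    rw [hV] at this
    rw [this] at hsub
    exact hL (sub_eq_zero.1 hsub.symm)
  -- hence `A_C V` is non-constant (tower), hence its mean absolute deviation is positive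
  obtain ⟨η₁, η₂, hη⟩ := exists_ne_coordAvg_of_subset μ hCs hVc hne
  haveI : (uniformSphere (volume : Measure E)).IsOpenPosMeasure := by
    rw [uniformSphere]
    exact Measure.isOpenPosMeasure_smul _ (ENNReal.inv_ne_zero.2 (measure_ne_top _ _))
  haveI : (Measure.pi (fun _ : Λ => uniformSphere (volume : Measure E))).IsOpenPosMeasure :=
    Measure.pi.isOpenPosMeasure _
  have hAc : Continuous (coordAvg μ C V) := continuous_coordAvg _ _ hVc
  have hmean : ∫ ω, coordAvg μ C V ω ∂Measure.pi (fun _ : Λ => μ) = ∫ ω, V ω ∂Measure.pi (fun _ : Λ => μ) :=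
    integral_coordAvg _ _ hVc
  have hpos := integral_abs_sub_mean_pos_of_ne (P := Measure.pi (fun _ : Λ => μ)) hAc hη
  rw [hmean] at hpos
  exact hpos

end Static

end Summit.Ventures.LatticeQCDFlow.Exactness

end
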